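import Literature.AlgebraicGeometry.HodgeTheory.CyclicCoverDeckIsMonodromy
import Summits.HodgeConjecture.HodgeConjecture.Theorems.CyclicUnitaryPowersPLPackageOfMeridians
import HarnessLib

/-!
# `VeryGeneralDeckCommutatorsInHg` and the rung leaf modulo THREE local printed facts
# (stub `stub_ct99InvariantsDeck` discharged) (route `CyclicUnitaryPowers`, item stmt-HodgeConjecture-19544)

Registered line `unitary-reflection-zariski` (skeleton v10, planner-hodge-nonav-p3-g29): the binder
`stub_ct99InvariantsDeck : carlsonToledo1999_monodromyInvariants_eq_deckInvariants` (Carlson–Toledo 1999 §3 ¶2 /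
§7 last ¶ read on the cyclic family: monodromy invariants are deck invariants) is a THEOREM of the tree —
`Literature.AlgebraicGeometry.HodgeTheory.carlsonToledo1999_monodromyInvariants_eq_deckInvariants_holds`
(file `CyclicCoverDeckIsMonodromy`: the covering transformation is itself the monodromy of the scaling loop
`u ↦ [x₃^p − e^{2πiu} f]` of the affine base). Hence, with prover-Bx g8's composition
`CyclicUnitaryPowersPLPackageOfMeridians.veryGeneralDeckCommutatorsInHg_of_meridian_facts`:

**K1 `VeryGeneralDeckCommutatorsInHg` and the rung-F-H1 leaf `CyclicSurfacePowersHodge` hold MODULO exactly three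
cited facts**: F1 `carlsonToledo1999_meridianMonodromy_isCyclicReflection` (CT99 §1 + §6 Proposition, LOCAL
Picard–Lefschetz for one meridian), CT2 `carlsonToledo1999_finrank_eigenspace_inf_hodgePiece` (CT99 §5 via
Griffiths residues) and CDK `cmsp_nonHodgeGenericPoints_countable_algebraic_cover`. CONDITIONAL; rung F-H1 not
moved; nothing here says HC ∕ HC_AV is proved.
-/

set_option linter.dupNamespace false

namespace Summit.HodgeConjecture.HodgeConjecture.Theorems.CyclicUnitaryPowersThreeLocalFacts

open Literature.AlgebraicGeometry.HodgeTheory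

/-- **K1 modulo the three local printed facts F1, CT2, CDK.** CONDITIONAL. -/
theorem veryGeneralDeckCommutatorsInHg_of_three_local_facts
    (H1 : carlsonToledo1999_meridianMonodromy_isCyclicReflection)
    (hCT2 : carlsonToledo1999_finrank_eigenspace_inf_hodgePiece)
    (hCDK : cmsp_nonHodgeGenericPoints_countable_algebraic_cover) :
    Summit.HodgeConjecture.HodgeConjecture.Theses.CyclicUnitaryPowers.VeryGeneralDeckCommutatorsInHg :=
  CyclicUnitaryPowersPLPackageOfMeridians.veryGeneralDeckCommutatorsInHg_of_meridian_facts @H1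
    @carlsonToledo1999_monodromyInvariants_eq_deckInvariants_holds @hCT2 @hCDK

/-- **The rung-F-H1 leaf modulo the same three facts.** CONDITIONAL; rung F-H1 not moved. -/
theorem cyclicSurfacePowersHodge_of_three_local_facts
    (H1 : carlsonToledo1999_meridianMonodromy_isCyclicReflection)
    (hCT2 : carlsonToledo1999_finrank_eigenspace_inf_hodgePiece)
    (hCDK : cmsp_nonHodgeGenericPoints_countable_algebraic_cover) :
    Summit.HodgeConjecture.HodgeConjecture.Theses.CyclicUnitaryPowers.CyclicSurfacePowersHodge :=
  CyclicUnitaryPowersPLPackageOfMeridians.cyclicSurfacePowersHodge_of_meridian_facts @H1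
    @carlsonToledo1999_monodromyInvariants_eq_deckInvariants_holds @hCT2 @hCDK

end Summit.HodgeConjecture.HodgeConjecture.Theorems.CyclicUnitaryPowersThreeLocalFacts
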